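import Literature.Computability.Cryptography.UOWHFTreeHash
import Literature.Computability.Complexity.LengthCompare
import HarnessLib

/-!
# Tree hashing of a leveled halving family, II: the polynomial-time evaluator and the collection

Topic `Literature/Computability/Cryptography`; continues `UOWHFTreeHash.lean` (Goldreich 2004, Constructions 6.4.24/6.4.26).
The tree hash `treeOut S n kb x` of the previous file as a composition of FP bricks on `⟨s, x⟩`, in three stages:

1. **depth**: a clocked doubling loop `(t, P) ↦ (t+1, 2P)` while `|x| + 1 > P`, from `(0, m)`, `L(n)` rounds, ending at
   `(min(depth, L), m·2^{min(depth, L)})` (`loopD`, `loopModel_bodyD`); the input is in range iff `|x| + 1 ≤ P` at the end;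
2. **levels**: padding `x 1 0^{P−|x|−1}` (`padF`) and a clocked loop of `t` rounds whose body is the blockwise hash of a level
   (`stepT`, a `foldCat` over the `2m`-bit blocks; `bodyT`, `loopT`, `loopModel_bodyT`);
3. **output**: `⟨t⟩ ++ z_t` fitted to `aL` depth bits, or zeros when out of range (`outT`),

and the whole brick `hashT S` on `⟨s, x⟩` (level read off `|s|` by `LenPres.nOfFn`, output fitted to `aL + m` at that level,
so the range condition holds on ALL inputs): `hashT_apply` (`= treeOut` on well-formed indices, every `x`), `length_hashT`,
`hashT_mem_FP`; the collection `treeHash S := pShaped S.pT (hashT S)` with `isEfficient_treeHash`, `hasRange_treeHash`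
(at the level of `|s|`), `length_index_treeHash`, `treeHash_hash_eq`. All proved; no named facts.

## References

* O. Goldreich, *Foundations of Cryptography II*, CUP 2004, §6.4.3.2, Constructions 6.4.24 and 6.4.26 ("Clearly, … polynomial-time").
* S. Arora, B. Barak, *Computational Complexity*, CUP 2009, §1.3 (closure of polynomial time under bounded loops).
-/

namespace Literature.Computability.Cryptography

namespace TreeHash

open _root_.Computability Complexity Complexity.Brick Complexity.Plumb Complexity.BitCodec Polynomial
open HHRVW (catF catF_apply catF_mem_FP fitLen length_fitLen fitLen_of_length_eq)
open MDCompose (pShaped pShaped_index_run pShaped_hash nOf_length_idx length_index_pShaped Xrec CnF CkbF CxF XnF_X XkF_X XxF_X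
  XnF_mem_FP XkF_mem_FP XxF_mem_FP)

variable (S : TSpec)

/-! ### Stage 1: the depth loop -/

section Depth

/-- The model of one round of the doubling loop on `(t, P)`. [folklore] -/
def stepD (ℓ : ℕ) (tp : ℕ × ℕ) : ℕ × ℕ := if ℓ + 1 ≤ tp.2 then tp else (tp.1 + 1, 2 * tp.2)

/-- `k` rounds of the doubling loop from `(0, m)` reach `(min(depth, k), m·2^{min(depth, k)})`. [folklore] -/
theorem iterate_stepD {m : ℕ} (hm : 1 ≤ m) (ℓ : ℕ) : ∀ k, (stepD ℓ)^[k] (0, m) = (min (depth m ℓ) k, m * 2 ^ min (depth m ℓ) k)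
  | 0 => by simp
  | k + 1 => by
    rw [Function.iterate_succ_apply', iterate_stepD hm ℓ k, stepD]
    by_cases hk : depth m ℓ ≤ k
    · rw [min_eq_left hk, if_pos (le_pow_depth hm ℓ), min_eq_left (Nat.le_succ_of_le hk)]
    · push Not at hk
      rw [min_eq_right hk.le, if_neg (not_le.2 (lt_of_lt_depth hm hk)), min_eq_right (Nat.succ_le_of_lt hk), pow_succ]
      simp only [Prod.mk.injEq, true_and]; ring

/-- On the loop record `⟨X, ⟨cnt, ⟨1ᵗ, 1ᴾ⟩⟩⟩`: the test `|x| + 1 ≤ P`. [folklore] -/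
noncomputable def condD : List Bool → List Bool := lenLeFn Polynomial.X ∘ fanoutFn (sndPow 2) (List.cons true ∘ CxF ∘ nthF 0)

/-- The doubling round `⟨1ᵗ, 1ᴾ⟩ ↦ ⟨1ᵗ⁺¹, 1²ᴾ⟩` unless the test holds. [folklore] -/
noncomputable def rawD : List Bool → List Bool := iteFn condD (sndPow 1) (fanoutFn (List.cons true ∘ nthF 2) (catF (sndPow 2) (sndPow 2)))

/-- The clip bound of the depth loop: the state has at most `2·PL + 2·Pm + 4X + 8` symbols on the intended records. [folklore] -/
noncomputable def QD : Polynomial ℕ := C 2 * S.PL + C 2 * S.Pm + C 4 * Polynomial.X + C 8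

/-- The body of the depth loop (clipped). [folklore] -/
noncomputable def bodyD : List Bool → List Bool := pclipF (QD S) rawD

variable (n : ℕ) (kb x : List Bool)

/-- The depth-loop record. [folklore] -/
def Drec (cnt : List Bool) (t P : ℕ) : List Bool := boolPair (Xrec n kb x) (boolPair cnt (boolPair (ones t) (ones P)))

variable {n kb x}

/-- Value of the test. [folklore] -/
theorem condD_D (cnt : List Bool) (t P : ℕ) : condD (Drec n kb x cnt t P) = [decide (x.length + 1 ≤ P)] := by
  rw [condD, Drec]
  simp only [Function.comp_apply, fanoutFn_apply, sndPow_succ_boolPair, sndPow_zero_boolPair, nthF_zero_boolPair, XxF_X, lenLeFn_boolPair,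
    eval_X, List.length_cons]
  simp [ones]

/-- Value of the unclipped round. [folklore] -/
theorem rawD_D (cnt : List Bool) (t P : ℕ) :
    rawD (Drec n kb x cnt t P) = boolPair (ones (stepD x.length (t, P)).1) (ones (stepD x.length (t, P)).2) := by
  rw [rawD]
  by_cases h : x.length + 1 ≤ P
  · rw [iteFn_apply_true (by rw [condD_D, decide_eq_true h]), stepD, if_pos h, Drec, sndPow_succ_boolPair, sndPow_zero_boolPair]
  · rw [iteFn_apply_false (by rw [condD_D, decide_eq_false h]), stepD, if_neg h, Drec]
    simp [fanoutFn_apply, nthF, ones, List.replicate_succ, two_mul]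

/-- The clip is inactive on states of the intended sizes (`t + 1 ≤ PL(n)`, `P ≤ 2|x| + 2m`). [folklore] -/
theorem bodyD_D (hS : S.WF) (cnt : List Bool) {t P : ℕ} (ht : t + 1 ≤ S.PL.eval n) (hP : P ≤ 2 * x.length + 2 * S.m n) :
    bodyD S (Drec n kb x cnt t P) = boolPair (ones (stepD x.length (t, P)).1) (ones (stepD x.length (t, P)).2) := by
  rw [bodyD, pclipF_eq_self, rawD_D]
  rw [rawD_D, Drec, fstF_boolPair]
  have hX : n ≤ (Xrec n kb x).length ∧ x.length ≤ (Xrec n kb x).length := by simp [Xrec, ones]; omega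
  have hPL : S.PL.eval n ≤ S.PL.eval (Xrec n kb x).length := TM2Iter.eval_mono S.PL hX.1
  have hPm : S.m n ≤ S.Pm.eval (Xrec n kb x).length := (hS.m_le n).trans (TM2Iter.eval_mono S.Pm hX.1)
  simp only [QD, eval_add, eval_mul, eval_C, eval_X, length_boolPair, stepD]
  split_ifs with h <;> simp only [ones, List.length_replicate] <;> omega

/-- **The depth loop computes `(min(depth, k), m·2^{min(depth, k)})`** after `k ≤ L(n)` rounds from `(0, m)`. [folklore] -/
theorem loopModel_bodyD (hS : S.WF) {k : ℕ} (hk : k ≤ S.L n) :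
    loopModel (bodyD S) (Xrec n kb x) k (boolPair (ones 0) (ones (S.m n))) =
      boolPair (ones (min (depth (S.m n) x.length) k)) (ones (S.m n * 2 ^ min (depth (S.m n) x.length) k)) := by
  have hm := hS.one_le_m n
  have hPbound : ∀ j, S.m n * 2 ^ min (depth (S.m n) x.length) j ≤ 2 * x.length + 2 * S.m n := fun j =>
    le_trans (Nat.mul_le_mul_left _ (Nat.pow_le_pow_right (by norm_num) (min_le_left _ _))) (pow_depth_le hm x.length)
  -- generalise over the starting round
  suffices H : ∀ (k j : ℕ), j + k ≤ S.L n →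
      loopModel (bodyD S) (Xrec n kb x) k (boolPair (ones (min (depth (S.m n) x.length) j)) (ones (S.m n * 2 ^ min (depth (S.m n) x.length) j))) =
        boolPair (ones (min (depth (S.m n) x.length) (j + k))) (ones (S.m n * 2 ^ min (depth (S.m n) x.length) (j + k))) by
    have := H k 0 (by omega)
    rw [Nat.zero_add, Nat.min_zero, pow_zero, mul_one] at this
    exact this
  intro k
  induction k with
  | zero => intro j _; rw [Nat.add_zero]; rfl
  | succ k ih =>
    intro j hj
    have hstep : stepD x.length (min (depth (S.m n) x.length) j, S.m n * 2 ^ min (depth (S.m n) x.length) j) =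
        (min (depth (S.m n) x.length) (j + 1), S.m n * 2 ^ min (depth (S.m n) x.length) (j + 1)) := by
      have h1 := iterate_stepD hm x.length j
      have h2 := iterate_stepD hm x.length (j + 1)
      rw [Function.iterate_succ_apply', h1] at h2
      exact h2
    rw [loopModel, show boolPair (Xrec n kb x) (boolPair (encodeNat (k + 1)) (boolPair (ones (min (depth (S.m n) x.length) j))
        (ones (S.m n * 2 ^ min (depth (S.m n) x.length) j)))) = Drec n kb x (encodeNat (k + 1)) _ _ from rfl,
      bodyD_D S hS _ (by have := hS.L_le n; omega) (hPbound j), hstep, ih (j + 1) (by omega),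
      show j + 1 + k = j + (k + 1) by omega]

end Depth

/-! ### Stage 1, packaged: the depth record `X₂ = ⟨X, ⟨1ᵗ, 1ᴾ⟩⟩` -/

section DepthPack

/-- `onesFn w = 1^{|w|}` (a twin of `CondRed.onesFn_eq_ones` in `LiuPassCondRedProgram.lean`, which is not imported here to keep
the import closure of the UOWHF line small). [folklore] -/
theorem onesFn_eq_ones (w : List Bool) : onesFn w = ones w.length := by
  simp [onesFn, Complexity.unaryEncodeNat_eq_replicate, ones]

/-- The initialisation of the depth loop `X ↦ ⟨X, ⟨bin L, ⟨1⁰, 1ᵐ⟩⟩⟩`. [folklore] -/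
noncomputable def initD : List Bool → List Bool :=
  fanoutFn id (fanoutFn (lenBinF ∘ S.LF ∘ CnF) (fanoutFn (fun _ => []) (S.mF ∘ CnF)))

/-- The clocked depth loop: `PL(|X|) ≥ L` rounds. [folklore] -/
noncomputable def loopD (z : List Bool) : List Bool := (loopStep (bodyD S))^[S.PL.eval (fstF z).length] z

/-- **The depth stage** `X ↦ X₂ = ⟨X, ⟨1ᵗ, 1ᴾ⟩⟩` with `t = min(depth, L)`, `P = m·2ᵗ`. [folklore] -/
noncomputable def depthP : List Bool → List Bool := fanoutFn (nthF 0) (sndPow 1) ∘ loopD S ∘ initD S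

variable (n : ℕ) (kb x : List Bool)

/-- The clipped depth `min(depth, L)`. [folklore] -/
noncomputable def tc : ℕ := min (depth (S.m n) x.length) (S.L n)

/-- The record `X₂ = ⟨X, ⟨1ᵗ, 1ᴾ⟩⟩`. [folklore] -/
def X2rec (t P : ℕ) : List Bool := boolPair (Xrec n kb x) (boolPair (ones t) (ones P))

variable {n kb x}

/-- Accessor values on `X₂`. [folklore] -/
@[simp] theorem X2rec_fstF (t P : ℕ) : fstF (X2rec n kb x t P) = Xrec n kb x := by rw [X2rec, fstF_boolPair]
/-- Accessor values on `X₂`. [folklore] -/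
@[simp] theorem X2rec_nthF1 (t P : ℕ) : nthF 1 (X2rec n kb x t P) = ones t := by rw [X2rec, nthF_succ_boolPair, nthF_zero_boolPair]
/-- Accessor values on `X₂`. [folklore] -/
@[simp] theorem X2rec_sndPow1 (t P : ℕ) : sndPow 1 (X2rec n kb x t P) = ones P := by rw [X2rec, sndPow_succ_boolPair, sndPow_zero_boolPair]

/-- Value of the initialisation of the depth loop. [folklore] -/
theorem initD_X (hS : S.WF) : initD S (Xrec n kb x) = Drec n kb x (encodeNat (S.L n)) 0 (S.m n) := by
  rw [initD]
  simp only [fanoutFn_apply, id, Function.comp_apply, XnF_X, hS.LF_apply, hS.mF_apply, lenBinF_apply, Drec]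
  simp [ones]

/-- **Value of the depth stage.** [folklore] -/
theorem depthP_apply (hS : S.WF) : depthP S (Xrec n kb x) = X2rec n kb x (tc S n x) (S.m n * 2 ^ tc S n x) := by
  have hR : S.L n ≤ S.PL.eval (Xrec n kb x).length := (hS.L_le n).trans (TM2Iter.eval_mono S.PL (by simp [Xrec, ones]; omega))
  rw [depthP, Function.comp_apply, Function.comp_apply, initD_X S hS, Drec, loopD, fstF_boolPair, iterate_loopStep _ _ _ _ _ hR,
    loopModel_bodyD S hS le_rfl, fanoutFn_apply, nthF_zero_boolPair, sndPow_succ_boolPair, sndPow_zero_boolPair]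
  rfl

/-- Growth of the clipped depth body (what `loopFn_mem_FP_of_poly` asks). [folklore] -/
theorem length_bodyD_le (z : List Bool) : (bodyD S z).length ≤ (sndPow 1 z).length + (QD S).eval (fstF z).length := by
  rw [bodyD]; exact (length_pclipF_le _ _ _).trans (Nat.le_add_left _ _)

/-- `condD ∈ FP`. [folklore] -/
theorem condD_mem_FP : condD ∈ FP :=
  comp_mem_FP (lenLeFn_mem_FP _) (fanoutFn_mem_FP (sndPow_mem_FP 2) (comp_mem_FP (cons_mem_FP true) (comp_mem_FP XxF_mem_FP (nthF_mem_FP 0))))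

/-- `bodyD ∈ FP`. [folklore] -/
theorem bodyD_mem_FP : bodyD S ∈ FP :=
  pclipF_mem_FP _ (iteFn_mem_FP condD_mem_FP (sndPow_mem_FP 1)
    (fanoutFn_mem_FP (comp_mem_FP (cons_mem_FP true) (nthF_mem_FP 2)) (catF_mem_FP (sndPow_mem_FP 2) (sndPow_mem_FP 2))))

/-- `depthP ∈ FP`. [folklore] -/
theorem depthP_mem_FP (hS : S.WF) : depthP S ∈ FP :=
  comp_mem_FP (fanoutFn_mem_FP (nthF_mem_FP 0) (sndPow_mem_FP 1))
    (comp_mem_FP (loopFn_mem_FP_of_poly (bodyD_mem_FP S) (QD S) (length_bodyD_le S) S.PL)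
      (fanoutFn_mem_FP (PolyTimeComputable.id _) (fanoutFn_mem_FP (comp_mem_FP lenBinF_mem_FP (comp_mem_FP hS.LF_mem XnF_mem_FP))
        (fanoutFn_mem_FP (const_mem_FP _) (comp_mem_FP hS.mF_mem XnF_mem_FP)))))

/-- The clipped depth is the depth for inputs in range, and `|x| + 1 ≤ P` holds exactly then. [folklore] -/
theorem tc_eq_of_le (hx : depth (S.m n) x.length ≤ S.L n) : tc S n x = depth (S.m n) x.length := min_eq_left hx

/-- In range iff the final `P` accommodates `x`. [folklore] -/
theorem le_pow_tc_iff (hS : S.WF) : x.length + 1 ≤ S.m n * 2 ^ tc S n x ↔ depth (S.m n) x.length ≤ S.L n := by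
  constructor
  · intro h; exact le_trans (depth_le_of_le (hS.one_le_m n) h) (min_le_right _ _)
  · intro h; rw [tc_eq_of_le S h]; exact le_pow_depth (hS.one_le_m n) _

end DepthPack

/-! ### Stage 2: padding and the level loop -/

section Levels

/-- On `X₂`: the test "in range" `|x| + 1 ≤ P`. [folklore] -/
noncomputable def inRangeF : List Bool → List Bool := lenLeFn Polynomial.X ∘ fanoutFn (sndPow 1) (List.cons true ∘ CxF ∘ fstF)

/-- On `X₂`: the padding `x 1 0^{P−|x|−1}`. [cite: Goldreich2004, Construction 6.4.24] -/
noncomputable def padF : List Bool → List Bool :=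
  catF (catF (CxF ∘ fstF) fun _ => [true]) (Kannan.zerosFn ∘ dropFn ∘ fanoutFn (List.cons true ∘ CxF ∘ fstF) (sndPow 1))

/-- On the level record `Z = ⟨X₂, ⟨cnt, ⟨1ⁱ, z⟩⟩⟩`: `1ⁿ`. [folklore] -/
noncomputable def ZnF : List Bool → List Bool := CnF ∘ fstF ∘ nthF 0
/-- On `Z`: `1^{P(n)}`. [folklore] -/
noncomputable def ZPF : List Bool → List Bool := polyFn S.P ∘ ZnF
/-- On `Z`: `1^{2m}`. [folklore] -/
noncomputable def Z2mF : List Bool → List Bool := catF (S.mF ∘ ZnF) (S.mF ∘ ZnF)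
/-- On `Z`: key `i`. [cite: Goldreich2004, Construction 6.4.26] -/
noncomputable def ZkeyF : List Bool → List Bool :=
  takeFn ∘ fanoutFn (ZPF S) (dropFn ∘ fanoutFn (HashBricks.umulFn ∘ fanoutFn (nthF 2) (ZPF S)) (CkbF ∘ fstF ∘ nthF 0))
/-- On `Z`: the basic index `1ⁿ 0 key_i`. [folklore] -/
noncomputable def ZidxF : List Bool → List Bool := catF (ZnF) (List.cons false ∘ ZkeyF S)
/-- On `Z`: the context `⟨idx, ⟨1^{2m}, z⟩⟩` of the blockwise fold. [folklore] -/
noncomputable def ZctxF : List Bool → List Bool := fanoutFn (ZidxF S) (fanoutFn (Z2mF S) (sndPow 2))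
/-- On `Z`: the number of blocks `1^{|z|/2m}`. [folklore] -/
noncomputable def ZuF : List Bool → List Bool := fstF ∘ divModFn ∘ fanoutFn (Z2mF S) (onesFn ∘ sndPow 2)
/-- On the fold pair `⟨ctx, 1ʲ⟩`: block `j` of `z`. [folklore] -/
noncomputable def blkF : List Bool → List Bool :=
  takeFn ∘ fanoutFn (nthF 1 ∘ fstF) (dropFn ∘ fanoutFn (HashBricks.umulFn ∘ fanoutFn sndF (nthF 1 ∘ fstF)) (sndPow 1 ∘ fstF))
/-- On the fold pair: the piece `h_{idx}(block j)`. [cite: Goldreich2004, Construction 6.4.24] -/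
noncomputable def pieceF : List Bool → List Bool := S.hb ∘ fanoutFn (fstF ∘ fstF) blkF
/-- On `Z`: **the blockwise hash of the level**. [cite: Goldreich2004, Construction 6.4.24] -/
noncomputable def stepT : List Bool → List Bool := foldCat Polynomial.X Polynomial.X (pieceF S) ∘ fanoutFn (ZctxF S) (ZuF S)
/-- The clip bound of the level loop. [folklore] -/
noncomputable def QT : Polynomial ℕ := C 2 * S.PL + Polynomial.X + C 4
/-- The body of the level loop `⟨1ⁱ, z⟩ ↦ ⟨1ⁱ⁺¹, blockwise (key i) z⟩` (clipped). [cite: Goldreich2004, Construction 6.4.26] -/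
noncomputable def bodyT : List Bool → List Bool := pclipF (QT S) (fanoutFn (List.cons true ∘ nthF 2) (stepT S))
/-- The initialisation of the level loop `X₂ ↦ ⟨X₂, ⟨bin t, ⟨1⁰, pad⟩⟩⟩`. [folklore] -/
noncomputable def initT : List Bool → List Bool := fanoutFn id (fanoutFn (lenBinF ∘ nthF 1) (fanoutFn (fun _ => []) (padF)))
/-- The clocked level loop. [folklore] -/
noncomputable def loopT (z : List Bool) : List Bool := (loopStep (bodyT S))^[S.PL.eval (fstF z).length] z
/-- **The top level** `X₂ ↦ z_t`. [cite: Goldreich2004, Construction 6.4.26] -/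
noncomputable def topF : List Bool → List Bool := sndPow 2 ∘ loopT S ∘ initT

variable (n : ℕ) (kb x : List Bool)

/-- The level-loop record. [folklore] -/
def Zrec (t P : ℕ) (cnt : List Bool) (i : ℕ) (z : List Bool) : List Bool := boolPair (X2rec n kb x t P) (boolPair cnt (boolPair (ones i) z))

variable {n kb x}

/-- Value of the range test. [folklore] -/
theorem inRangeF_X2 (t P : ℕ) : inRangeF (X2rec n kb x t P) = [decide (x.length + 1 ≤ P)] := by
  rw [inRangeF, X2rec]
  simp only [Function.comp_apply, fanoutFn_apply, sndPow_succ_boolPair, sndPow_zero_boolPair, fstF_boolPair, XxF_X, lenLeFn_boolPair,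
    eval_X, List.length_cons]
  simp [ones]

/-- Value of the padding, in range. [folklore] -/
theorem padF_X2 (t : ℕ) :
    padF (X2rec n kb x t (S.m n * 2 ^ depth (S.m n) x.length)) = padStr (S.m n) x := by
  rw [padF, X2rec]
  simp only [catF_apply, Function.comp_apply, fanoutFn_apply, fstF_boolPair, XxF_X, sndPow_succ_boolPair, sndPow_zero_boolPair,
    dropFn_boolPair, Kannan.zerosFn_apply, List.length_drop, List.length_cons, padStr]
  simp only [ones, List.length_replicate, List.append_assoc, List.singleton_append, Nat.sub_sub]

/-- Accessor values on `Z`. [folklore] -/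
@[simp] theorem Zrec_nthF0 (t P : ℕ) (cnt : List Bool) (i : ℕ) (z : List Bool) : nthF 0 (Zrec n kb x t P cnt i z) = X2rec n kb x t P := by
  rw [Zrec, nthF_zero_boolPair]
/-- Accessor values on `Z`. [folklore] -/
@[simp] theorem Zrec_nthF2 (t P : ℕ) (cnt : List Bool) (i : ℕ) (z : List Bool) : nthF 2 (Zrec n kb x t P cnt i z) = ones i := by
  rw [Zrec, nthF_succ_boolPair, nthF_succ_boolPair, nthF_zero_boolPair]
/-- Accessor values on `Z`. [folklore] -/
@[simp] theorem Zrec_sndPow2 (t P : ℕ) (cnt : List Bool) (i : ℕ) (z : List Bool) : sndPow 2 (Zrec n kb x t P cnt i z) = z := by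
  rw [Zrec, sndPow_succ_boolPair, sndPow_succ_boolPair, sndPow_zero_boolPair]
/-- Accessor values on `Z`. [folklore] -/
@[simp] theorem Zrec_fstF (t P : ℕ) (cnt : List Bool) (i : ℕ) (z : List Bool) : fstF (Zrec n kb x t P cnt i z) = X2rec n kb x t P := by
  rw [Zrec, fstF_boolPair]

/-- Accessor values on `Z`. [folklore] -/
theorem ZnF_Z (t P : ℕ) (cnt : List Bool) (i : ℕ) (z : List Bool) : ZnF (Zrec n kb x t P cnt i z) = ones n := by
  simp only [ZnF, Function.comp_apply, Zrec_nthF0, X2rec_fstF, XnF_X]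
/-- Accessor values on `Z`. [folklore] -/
theorem ZPF_Z (t P : ℕ) (cnt : List Bool) (i : ℕ) (z : List Bool) : ZPF S (Zrec n kb x t P cnt i z) = ones (S.P.eval n) := by
  rw [ZPF, Function.comp_apply, ZnF_Z, polyFn_apply]; simp [ones]
/-- Accessor values on `Z`. [folklore] -/
theorem Z2mF_Z (hS : S.WF) (t P : ℕ) (cnt : List Bool) (i : ℕ) (z : List Bool) : Z2mF S (Zrec n kb x t P cnt i z) = ones (2 * S.m n) := by
  rw [Z2mF, catF_apply, Function.comp_apply, ZnF_Z, hS.mF_apply]; simp [ones, two_mul]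
/-- Accessor values on `Z`. [folklore] -/
theorem ZkeyF_Z (t P : ℕ) (cnt : List Bool) (i : ℕ) (z : List Bool) : ZkeyF S (Zrec n kb x t P cnt i z) = keyAt S n kb i := by
  rw [ZkeyF]
  simp only [Function.comp_apply, fanoutFn_apply, ZPF_Z, Zrec_nthF2, Zrec_nthF0, X2rec_fstF, XkF_X,
    HashBricks.umulFn_boolPair, takeFn_boolPair, dropFn_boolPair, keyAt]
  simp [ones]
/-- Accessor values on `Z`. [folklore] -/
theorem ZidxF_Z (t P : ℕ) (cnt : List Bool) (i : ℕ) (z : List Bool) : ZidxF S (Zrec n kb x t P cnt i z) = idxAt S n kb i := by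
  rw [ZidxF, catF_apply, ZnF_Z, Function.comp_apply, ZkeyF_Z, idxAt]
/-- Accessor values on `Z`. [folklore] -/
theorem ZctxF_Z (hS : S.WF) (t P : ℕ) (cnt : List Bool) (i : ℕ) (z : List Bool) :
    ZctxF S (Zrec n kb x t P cnt i z) = boolPair (idxAt S n kb i) (boolPair (ones (2 * S.m n)) z) := by
  rw [ZctxF, fanoutFn_apply, fanoutFn_apply, ZidxF_Z, Z2mF_Z S hS, Zrec_sndPow2]
/-- Accessor values on `Z`. [folklore] -/
theorem ZuF_Z (hS : S.WF) (t P : ℕ) (cnt : List Bool) (i : ℕ) (z : List Bool) : ZuF S (Zrec n kb x t P cnt i z) = ones (z.length / (2 * S.m n)) := by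
  rw [ZuF, Function.comp_apply, Function.comp_apply, fanoutFn_apply, Z2mF_Z S hS, Function.comp_apply, Zrec_sndPow2, onesFn_eq_ones,
    divModFn_boolPair, fstF_boolPair]

/-- Value of a piece of the fold. [folklore] -/
theorem pieceF_apply (r : List Bool) (m2 : ℕ) (z : List Bool) (j : ℕ) :
    pieceF S (boolPair (boolPair r (boolPair (ones m2) z)) (ones j)) = S.hb (boolPair r ((z.drop (j * m2)).take m2)) := by
  rw [pieceF, Function.comp_apply, fanoutFn_apply, blkF]
  simp only [Function.comp_apply, fanoutFn_apply, fstF_boolPair, sndF_boolPair, nthF_succ_boolPair, nthF_zero_boolPair, sndPow_succ_boolPair,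
    sndPow_zero_boolPair, HashBricks.umulFn_boolPair, takeFn_boolPair, dropFn_boolPair]
  simp [ones]

/-- **Value of the blockwise step** on a level of `k` well-formed blocks. [cite: Goldreich2004, Construction 6.4.24] -/
theorem stepT_Z (hS : S.WF) (t P : ℕ) (cnt : List Bool) {i : ℕ} (hi : i < S.L n) (hkb : S.L n * S.P.eval n ≤ kb.length) {z : List Bool} {k : ℕ}
    (hz : z.length = k * (2 * S.m n)) : stepT S (Zrec n kb x t P cnt i z) = blockwise S n (keyAt S n kb i) z := by
  have hm := hS.one_le_m n
  have hkeq : z.length / (2 * S.m n) = k := by rw [hz, Nat.mul_div_cancel _ (by omega)]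
  rw [stepT, Function.comp_apply, fanoutFn_apply, ZctxF_Z S hS, ZuF_Z S hS, idxAt, foldCat_apply]
  · rw [blockwise]
    simp only [ones, List.length_replicate]
    refine ccat_congr fun j _ => ?_
    rw [← ones, ← ones, pieceF_apply, blk]
  · simp only [ones, List.length_replicate, eval_X, length_boolPair]
    exact (Nat.div_le_self _ _).trans (by omega)
  · intro j hj
    simp only [ones, List.length_replicate] at hj ⊢
    rw [← ones, ← ones, pieceF_apply, eval_X, hS.length_hb n _ _ (length_keyAt hkb hi) ?_]
    · simp only [length_boolPair, ones, List.length_replicate, List.length_append, List.length_cons]; omega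
    · rw [List.length_take, List.length_drop, hz, min_eq_left]
      rw [hkeq] at hj
      have := Nat.mul_le_mul_right (2 * S.m n) (Nat.succ_le_of_lt hj); rw [Nat.succ_mul] at this; omega

/-- The clip of the level loop is inactive on the intended records. [folklore] -/
theorem bodyT_Z (hS : S.WF) {t P : ℕ} (cnt : List Bool) {i : ℕ} (hi : i < S.L n) (hkb : S.L n * S.P.eval n ≤ kb.length) {z : List Bool} {k : ℕ}
    (hz : z.length = k * (2 * S.m n)) (hzP : z.length ≤ P) :
    bodyT S (Zrec n kb x t P cnt i z) = boolPair (ones (i + 1)) (blockwise S n (keyAt S n kb i) z) := by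
  have hval : fanoutFn (List.cons true ∘ nthF 2) (stepT S) (Zrec n kb x t P cnt i z) = boolPair (ones (i + 1)) (blockwise S n (keyAt S n kb i) z) := by
    rw [fanoutFn_apply, stepT_Z S hS t P cnt hi hkb hz]; simp [Zrec, ones, List.replicate_succ]
  rw [bodyT, pclipF_eq_self, hval]
  rw [hval, Zrec, fstF_boolPair, length_boolPair, length_blockwise hS (length_keyAt hkb hi) hz]
  have hX2 : n ≤ (X2rec n kb x t P).length ∧ P ≤ (X2rec n kb x t P).length := by simp [X2rec, Xrec, ones]; omega
  have hPL : S.L n ≤ S.PL.eval (X2rec n kb x t P).length := (hS.L_le n).trans (TM2Iter.eval_mono S.PL hX2.1)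
  have hm := hS.one_le_m n
  have hkz : k * S.m n ≤ z.length := by rw [hz]; nlinarith
  simp only [QT, eval_add, eval_mul, eval_C, eval_X, ones, List.length_replicate]
  omega

/-- **The level loop computes the levels**: from `⟨1ⁱ, z_i⟩` with `k` active rounds, `i + k ≤ t = depth ≤ L`, the model
ends at `⟨1^{i+k}, z_{i+k}⟩`. [cite: Goldreich2004, Construction 6.4.26] -/
theorem loopModel_bodyT (hS : S.WF) (hkb : S.L n * S.P.eval n ≤ kb.length) (hx : dep S n x ≤ S.L n) {t P : ℕ}
    (hP : S.m n * 2 ^ dep S n x ≤ P) :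
    ∀ (k i : ℕ), i + k ≤ dep S n x →
      loopModel (bodyT S) (X2rec n kb x t P) k (boolPair (ones i) (level S n kb x i)) = boolPair (ones (i + k)) (level S n kb x (i + k))
  | 0, _, _ => rfl
  | k + 1, i, hk => by
    have hlen := length_level hS hkb hx (i := i) (by omega)
    have hlen' : (level S n kb x i).length = 2 ^ (dep S n x - (i + 1)) * (2 * S.m n) := by
      rw [hlen, show dep S n x - i = dep S n x - (i + 1) + 1 by omega, pow_succ]; ring
    rw [loopModel, show boolPair (X2rec n kb x t P) (boolPair (encodeNat (k + 1)) (boolPair (ones i) (level S n kb x i))) =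
      Zrec n kb x t P (encodeNat (k + 1)) i (level S n kb x i) from rfl,
      bodyT_Z S hS _ (by omega) hkb hlen' (hlen ▸ le_trans (Nat.mul_le_mul_left _ (Nat.pow_le_pow_right (by norm_num) (Nat.sub_le _ _))) hP),
      show blockwise S n (keyAt S n kb i) (level S n kb x i) = level S n kb x (i + 1) from rfl,
      loopModel_bodyT hS hkb hx hP k (i + 1) (by omega)]
    congr 2 <;> omega

/-- Value of the initialisation of the level loop, in range. [folklore] -/
theorem initT_X2 :
    initT (X2rec n kb x (dep S n x) (S.m n * 2 ^ dep S n x)) =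
      Zrec n kb x (dep S n x) (S.m n * 2 ^ dep S n x) (encodeNat (dep S n x)) 0 (padStr (S.m n) x) := by
  rw [initT]
  simp only [fanoutFn_apply, id, Function.comp_apply, X2rec_nthF1, lenBinF_apply, dep, padF_X2, Zrec]
  simp [ones]

/-- **Value of the top-level stage**, in range. [cite: Goldreich2004, Construction 6.4.26] -/
theorem topF_apply (hS : S.WF) (hkb : S.L n * S.P.eval n ≤ kb.length) (hx : dep S n x ≤ S.L n) :
    topF S (X2rec n kb x (dep S n x) (S.m n * 2 ^ dep S n x)) = level S n kb x (dep S n x) := by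
  have hR : dep S n x ≤ S.PL.eval (X2rec n kb x (dep S n x) (S.m n * 2 ^ dep S n x)).length :=
    hx.trans ((hS.L_le n).trans (TM2Iter.eval_mono S.PL (by simp [X2rec, Xrec, ones]; omega)))
  rw [topF, Function.comp_apply, Function.comp_apply, initT_X2, Zrec, loopT, fstF_boolPair, iterate_loopStep _ _ _ _ _ hR,
    show padStr (S.m n) x = level S n kb x 0 from rfl, loopModel_bodyT S hS hkb hx le_rfl (dep S n x) 0 (by omega), Nat.zero_add,
    sndPow_succ_boolPair, sndPow_succ_boolPair, sndPow_zero_boolPair]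

/-- `stepT ∈ FP`. [folklore] -/
theorem stepT_mem_FP (hS : S.WF) : stepT S ∈ FP := by
  have hn : ZnF ∈ FP := comp_mem_FP XnF_mem_FP (comp_mem_FP fstF_mem_FP (nthF_mem_FP 0))
  have hP : ZPF S ∈ FP := comp_mem_FP (polyFn_mem_FP _) hn
  have h2m : Z2mF S ∈ FP := catF_mem_FP (comp_mem_FP hS.mF_mem hn) (comp_mem_FP hS.mF_mem hn)
  have hkey : ZkeyF S ∈ FP := comp_mem_FP takeFn_mem_FP (fanoutFn_mem_FP hP (comp_mem_FP dropFn_mem_FP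
    (fanoutFn_mem_FP (comp_mem_FP HashBricks.umulFn_mem_FP (fanoutFn_mem_FP (nthF_mem_FP 2) hP))
      (comp_mem_FP XkF_mem_FP (comp_mem_FP fstF_mem_FP (nthF_mem_FP 0))))))
  have hidx : ZidxF S ∈ FP := catF_mem_FP hn (comp_mem_FP (cons_mem_FP false) hkey)
  have hctx : ZctxF S ∈ FP := fanoutFn_mem_FP hidx (fanoutFn_mem_FP h2m (sndPow_mem_FP 2))
  have hu : ZuF S ∈ FP := comp_mem_FP fstF_mem_FP (comp_mem_FP divModFn_mem_FP (fanoutFn_mem_FP h2m (comp_mem_FP onesFn_mem_FP (sndPow_mem_FP 2))))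
  have hblk : blkF ∈ FP := comp_mem_FP takeFn_mem_FP (fanoutFn_mem_FP (comp_mem_FP (nthF_mem_FP 1) fstF_mem_FP)
    (comp_mem_FP dropFn_mem_FP (fanoutFn_mem_FP (comp_mem_FP HashBricks.umulFn_mem_FP (fanoutFn_mem_FP sndF_mem_FP (comp_mem_FP (nthF_mem_FP 1) fstF_mem_FP)))
      (comp_mem_FP (sndPow_mem_FP 1) fstF_mem_FP))))
  have hpiece : pieceF S ∈ FP := comp_mem_FP hS.hb_mem (fanoutFn_mem_FP (comp_mem_FP fstF_mem_FP fstF_mem_FP) hblk)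
  exact comp_mem_FP (foldCat_mem_FP _ _ hpiece) (fanoutFn_mem_FP hctx hu)

/-- `bodyT ∈ FP`. [folklore] -/
theorem bodyT_mem_FP (hS : S.WF) : bodyT S ∈ FP :=
  pclipF_mem_FP _ (fanoutFn_mem_FP (comp_mem_FP (cons_mem_FP true) (nthF_mem_FP 2)) (stepT_mem_FP S hS))

/-- Growth of the clipped level body. [folklore] -/
theorem length_bodyT_le (z : List Bool) : (bodyT S z).length ≤ (sndPow 1 z).length + (QT S).eval (fstF z).length := by
  rw [bodyT]; exact (length_pclipF_le _ _ _).trans (Nat.le_add_left _ _)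

/-- `padF ∈ FP` (unrelated to the homonymous `OracleComposition.padF_mem_FP`, a different padding). [folklore] -/
theorem padF_mem_FP : padF ∈ FP :=
  catF_mem_FP (catF_mem_FP (comp_mem_FP XxF_mem_FP fstF_mem_FP) (const_mem_FP _))
    (comp_mem_FP Kannan.zerosFn_mem_FP (comp_mem_FP dropFn_mem_FP (fanoutFn_mem_FP
      (comp_mem_FP (cons_mem_FP true) (comp_mem_FP XxF_mem_FP fstF_mem_FP)) (sndPow_mem_FP 1))))

/-- `topF ∈ FP`. [folklore] -/
theorem topF_mem_FP (hS : S.WF) : topF S ∈ FP :=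
  comp_mem_FP (sndPow_mem_FP 2) (comp_mem_FP (loopFn_mem_FP_of_poly (bodyT_mem_FP S hS) (QT S) (length_bodyT_le S) S.PL)
    (fanoutFn_mem_FP (PolyTimeComputable.id _) (fanoutFn_mem_FP (comp_mem_FP lenBinF_mem_FP (nthF_mem_FP 1)) (fanoutFn_mem_FP (const_mem_FP _) padF_mem_FP))))

end Levels

/-! ### Stage 3: the output, and the whole evaluator -/

section Output

/-- On `X₂`: `1^{aL}`. [folklore] -/
noncomputable def aLU : List Bool → List Bool := catF (onesFn ∘ lenBinF ∘ S.LF ∘ CnF ∘ fstF) fun _ => [true]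

/-- On `X₂`: the depth field `⟨t⟩` fitted to `aL` bits. [folklore] -/
noncomputable def depthFieldF : List Bool → List Bool :=
  catF (takeFn ∘ fanoutFn (aLU S) (lenBinF ∘ nthF 1)) (Kannan.zerosFn ∘ dropFn ∘ fanoutFn (lenBinF ∘ nthF 1) (aLU S))

/-- On `X₂`: the junk output `0^{aL + m}`. [folklore] -/
noncomputable def junkF : List Bool → List Bool := Kannan.zerosFn ∘ catF (aLU S) (S.mF ∘ CnF ∘ fstF)

/-- On `X₂`: **the output** `⟨t⟩ ++ z_t`, or junk out of range. [cite: Goldreich2004, Construction 6.4.26] -/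
noncomputable def outT : List Bool → List Bool := iteFn inRangeF (catF (depthFieldF S) (topF S)) (junkF S)

/-- The level of `s` in unary, from `⟨s, x⟩`. [folklore] -/
noncomputable def lvT : List Bool → List Bool := LenPres.nOfFn S.pT ∘ fstF

/-- `⟨s, x⟩ ↦ X = ⟨1^{lv}, ⟨s ⇂ (lv+1), x⟩⟩`. [folklore] -/
noncomputable def prepT : List Bool → List Bool :=
  fanoutFn (lvT S) (fanoutFn (dropFn ∘ fanoutFn (catF (lvT S) fun _ => [true]) fstF) sndF)

/-- The core evaluator on `⟨s, x⟩`. [folklore] -/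
noncomputable def coreT : List Bool → List Bool := outT S ∘ depthP S ∘ prepT S

/-- The range length `aL(lv) + m(lv)` in unary, from `⟨s, x⟩`. [folklore] -/
noncomputable def rlenT : List Bool → List Bool :=
  catF (catF (onesFn ∘ lenBinF ∘ S.LF ∘ lvT S) fun _ => [true]) (S.mF ∘ lvT S)

/-- **The tree hash brick** on `⟨s, x⟩`: the core evaluator, cut and padded to `aL(lv) + m(lv)` symbols at the level of `|s|`.
[cite: Goldreich2004, Construction 6.4.26 with Def. 6.4.18 (range)] -/
noncomputable def hashT : List Bool → List Bool :=
  catF (takeFn ∘ fanoutFn (rlenT S) (coreT S)) (Kannan.zerosFn ∘ dropFn ∘ fanoutFn (coreT S) (rlenT S))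

variable {S} {n : ℕ} {kb x : List Bool}

/-- Value of `aLU`. [folklore] -/
theorem aLU_X2 (hS : S.WF) (t P : ℕ) : aLU S (X2rec n kb x t P) = ones (aL S n) := by
  rw [aLU, catF_apply]
  simp only [Function.comp_apply, X2rec_fstF, XnF_X, hS.LF_apply, lenBinF_apply, onesFn_eq_ones, aL]
  rw [ones, ones, ones, List.length_replicate, List.replicate_succ']

/-- Value of the depth field. [folklore] -/
theorem depthFieldF_X2 (hS : S.WF) (t P : ℕ) : depthFieldF S (X2rec n kb x t P) = fitLen (aL S n) (encodeNat t) := by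
  rw [depthFieldF, catF_apply]
  simp only [Function.comp_apply, fanoutFn_apply, aLU_X2 hS, X2rec_nthF1, lenBinF_apply, takeFn_boolPair, dropFn_boolPair, Kannan.zerosFn_apply,
    List.length_drop, fitLen]
  simp [ones]

/-- Value of the junk output. [folklore] -/
theorem junkF_X2 (hS : S.WF) (t P : ℕ) : junkF S (X2rec n kb x t P) = List.replicate (aL S n + S.m n) false := by
  rw [junkF, Function.comp_apply, catF_apply, aLU_X2 hS]
  simp only [Function.comp_apply, X2rec_fstF, XnF_X, hS.mF_apply, Kannan.zerosFn_apply, List.length_append]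
  simp [ones]

/-- **Value of the output stage**: `treeOut`. [cite: Goldreich2004, Construction 6.4.26] -/
theorem outT_apply (hS : S.WF) (hkb : S.L n * S.P.eval n ≤ kb.length) :
    outT S (X2rec n kb x (tc S n x) (S.m n * 2 ^ tc S n x)) = treeOut S n kb x := by
  rw [outT, treeOut]
  by_cases hx : depth (S.m n) x.length ≤ S.L n
  · have hr : x.length + 1 ≤ S.m n * 2 ^ tc S n x := (le_pow_tc_iff S hS).2 hx
    rw [iteFn_apply_true (by rw [inRangeF_X2, decide_eq_true hr]), catF_apply, depthFieldF_X2 hS, dep, if_pos hx, tc_eq_of_le S hx,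
      show depth (S.m n) x.length = dep S n x from rfl, topF_apply S hS hkb hx]
  · have hr : ¬ (x.length + 1 ≤ S.m n * 2 ^ tc S n x) := fun h => hx ((le_pow_tc_iff S hS).1 h)
    rw [iteFn_apply_false (by rw [inRangeF_X2, decide_eq_false hr]), junkF_X2 hS, dep, if_neg hx]

/-- Value of `lvT`. [folklore] -/
theorem lvT_apply (s x : List Bool) : lvT S (boolPair s x) = ones (LenPres.nOf S.pT s.length) := by
  rw [lvT, Function.comp_apply, fstF_boolPair, LenPres.nOfFn_apply]

/-- Value of `prepT` on a well-formed index. [folklore] -/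
theorem prepT_apply (n : ℕ) {kb : List Bool} (hkb : kb.length = S.pT.eval n) (x : List Bool) :
    prepT S (boolPair (ones n ++ false :: kb) x) = Xrec n kb x := by
  rw [prepT, fanoutFn_apply, fanoutFn_apply, Function.comp_apply, fanoutFn_apply, catF_apply, lvT_apply, nOf_length_idx S.pT n hkb,
    fstF_boolPair, sndF_boolPair, dropFn_boolPair, Xrec]
  have h : (ones n ++ [true]).length = (ones n ++ [false]).length := by simp
  rw [h, show ones n ++ false :: kb = (ones n ++ [false]) ++ kb by simp, List.drop_left]

/-- Value of `rlenT`. [folklore] -/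
theorem rlenT_apply (hS : S.WF) (s x : List Bool) :
    rlenT S (boolPair s x) = ones (aL S (LenPres.nOf S.pT s.length) + S.m (LenPres.nOf S.pT s.length)) := by
  rw [rlenT, catF_apply, catF_apply]
  simp only [Function.comp_apply, lvT_apply, hS.LF_apply, hS.mF_apply, lenBinF_apply, onesFn_eq_ones, aL]
  rw [ones, ones, ones, ones, List.length_replicate, List.replicate_add, List.replicate_succ']

/-- **Value of the core evaluator** on a well-formed index, for every `x`. [cite: Goldreich2004, Construction 6.4.26] -/
theorem coreT_apply (hS : S.WF) {n : ℕ} {kb : List Bool} (hkb : kb.length = S.pT.eval n) (x : List Bool) :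
    coreT S (boolPair (ones n ++ false :: kb) x) = treeOut S n kb x := by
  rw [coreT, Function.comp_apply, Function.comp_apply, prepT_apply n hkb, depthP_apply S hS, outT_apply hS (hkb ▸ hS.pT_ge n)]

/-- `hashT ⟨s, x⟩ = fitLen (aL(lv) + m(lv)) (coreT ⟨s, x⟩)`. [folklore] -/
theorem hashT_eq (hS : S.WF) (s x : List Bool) :
    hashT S (boolPair s x) = fitLen (aL S (LenPres.nOf S.pT s.length) + S.m (LenPres.nOf S.pT s.length)) (coreT S (boolPair s x)) := by
  rw [hashT, catF_apply, Function.comp_apply, fanoutFn_apply, Function.comp_apply, Function.comp_apply, fanoutFn_apply, rlenT_apply hS,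
    takeFn_boolPair, dropFn_boolPair, Kannan.zerosFn_apply, fitLen]
  simp [ones]

/-- **Range on all inputs**: `|hashT ⟨s, x⟩| = aL(lv) + m(lv)`, `lv = nOf pT |s|`. [cite: Goldreich2004, Def. 6.4.18 (range specifier)] -/
theorem length_hashT (hS : S.WF) (s x : List Bool) :
    (hashT S (boolPair s x)).length = aL S (LenPres.nOf S.pT s.length) + S.m (LenPres.nOf S.pT s.length) := by
  rw [hashT_eq hS, length_fitLen]

/-- **The value on well-formed indices, every input**: `hashT ⟨1ⁿ0kb, x⟩ = treeOut S n kb x`. [cite: Goldreich2004, Construction 6.4.26] -/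
theorem hashT_apply (hS : S.WF) {n : ℕ} {kb : List Bool} (hkb : kb.length = S.pT.eval n) (x : List Bool) :
    hashT S (boolPair (ones n ++ false :: kb) x) = treeOut S n kb x := by
  rw [hashT_eq hS, nOf_length_idx S.pT n hkb, coreT_apply hS hkb, fitLen_of_length_eq (length_treeOut hS (hkb ▸ hS.pT_ge n))]

/-- `hashT ∈ FP`. [cite: Goldreich2004, Construction 6.4.26 ("polynomial-time")] -/
theorem hashT_mem_FP (hS : S.WF) : hashT S ∈ FP := by
  have hlv : lvT S ∈ FP := comp_mem_FP (LenPres.nOfFn_mem_FP S.pT) fstF_mem_FP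
  have hprep : prepT S ∈ FP := fanoutFn_mem_FP hlv (fanoutFn_mem_FP
    (comp_mem_FP dropFn_mem_FP (fanoutFn_mem_FP (catF_mem_FP hlv (const_mem_FP _)) fstF_mem_FP)) sndF_mem_FP)
  have haLU : aLU S ∈ FP := catF_mem_FP (comp_mem_FP onesFn_mem_FP (comp_mem_FP lenBinF_mem_FP (comp_mem_FP hS.LF_mem
    (comp_mem_FP XnF_mem_FP fstF_mem_FP)))) (const_mem_FP _)
  have hdf : depthFieldF S ∈ FP := catF_mem_FP (comp_mem_FP takeFn_mem_FP (fanoutFn_mem_FP haLU (comp_mem_FP lenBinF_mem_FP (nthF_mem_FP 1))))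
    (comp_mem_FP Kannan.zerosFn_mem_FP (comp_mem_FP dropFn_mem_FP (fanoutFn_mem_FP (comp_mem_FP lenBinF_mem_FP (nthF_mem_FP 1)) haLU)))
  have hjunk : junkF S ∈ FP := comp_mem_FP Kannan.zerosFn_mem_FP (catF_mem_FP haLU (comp_mem_FP hS.mF_mem (comp_mem_FP XnF_mem_FP fstF_mem_FP)))
  have hin : inRangeF ∈ FP := comp_mem_FP (lenLeFn_mem_FP _) (fanoutFn_mem_FP (sndPow_mem_FP 1)
    (comp_mem_FP (cons_mem_FP true) (comp_mem_FP XxF_mem_FP fstF_mem_FP)))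
  have hout : outT S ∈ FP := iteFn_mem_FP hin (catF_mem_FP hdf (topF_mem_FP S hS)) hjunk
  have hcore : coreT S ∈ FP := comp_mem_FP hout (comp_mem_FP (depthP_mem_FP S hS) hprep)
  have hrlen : rlenT S ∈ FP := catF_mem_FP (catF_mem_FP (comp_mem_FP onesFn_mem_FP (comp_mem_FP lenBinF_mem_FP (comp_mem_FP hS.LF_mem hlv)))
    (const_mem_FP _)) (comp_mem_FP hS.mF_mem hlv)
  exact catF_mem_FP (comp_mem_FP takeFn_mem_FP (fanoutFn_mem_FP hrlen hcore))
    (comp_mem_FP Kannan.zerosFn_mem_FP (comp_mem_FP dropFn_mem_FP (fanoutFn_mem_FP hcore hrlen)))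

end Output

/-! ### The tree collection -/

section Collection

variable (S : TSpec)

/-- **The tree hashing of a leveled halving family** as a hash collection: `pT`-shaped, hash `hashT`.
[cite: Goldreich2004, Construction 6.4.26] -/
noncomputable def treeHash : HashCollection := pShaped S.pT (hashT S)

/-- The range length of the tree collection at index length `K`: `aL + m` at the level `nOf pT K`. [cite: Goldreich2004, Construction 6.4.26] -/
def rLenT (K : ℕ) : ℕ := aL S (LenPres.nOf S.pT K) + S.m (LenPres.nOf S.pT K)

variable {S}

/-- **Range (Def. 6.4.18's range specifier)**: `|h_s(x)| = rLenT |s|` for every `s` and EVERY `x`. [cite: Goldreich2004, Def. 6.4.18] -/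
theorem hasRange_treeHash (hS : S.WF) : (treeHash S).HasRange (rLenT S) := fun s x => length_hashT hS s x

/-- **Efficiency**. [cite: Goldreich2004, Construction 6.4.26; Def. 6.4.18 (2)] -/
theorem isEfficient_treeHash (hS : S.WF) : (treeHash S).IsEfficient := by
  constructor
  · refine ⟨?_, S.pT, fun L => le_rfl⟩
    have hg : catF fstF (List.cons false ∘ sndF) ∈ FP := catF_mem_FP fstF_mem_FP (comp_mem_FP (cons_mem_FP false) sndF_mem_FP)
    obtain ⟨pc, Mc, hM⟩ := hg
    refine ⟨pc, Mc, fun q => ?_⟩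
    have h := hM (boolPair (unaryEncodeNat q.1) q.2)
    rw [id, catF_apply, fstF_boolPair, Function.comp_apply, sndF_boolPair] at h
    exact h
  · obtain ⟨pc, Mc, hM⟩ := hashT_mem_FP hS
    exact ⟨pc, Mc, fun q => hM (boolPair q.1 q.2)⟩

/-- **Index length**: every index in the range of `I(1ⁿ)` has length `LenPres.M pT n`. [cite: Goldreich2004, Def. 6.4.18 (1)] -/
theorem length_index_treeHash {n : ℕ} {s : List Bool} (hs : s ∈ ((treeHash S).indexPMF n).support) : s.length = LenPres.M S.pT n :=
  length_index_pShaped hs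

/-- The coin budget of the tree sampler is `pT`. [folklore] -/
@[simp] theorem treeHash_index_coinLen (L : ℕ) : (treeHash S).index.coinLen L = S.pT.eval L := rfl

/-- **The value of the tree hash on well-formed indices, every input.** [cite: Goldreich2004, Construction 6.4.26] -/
theorem treeHash_hash_eq (hS : S.WF) {n : ℕ} {kb : List Bool} (hkb : kb.length = S.pT.eval n) (x : List Bool) :
    (treeHash S).hash (ones n ++ false :: kb) x = treeOut S n kb x :=
  hashT_apply hS hkb x

end Collection

end TreeHash

end Literature.Computability.Cryptography
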